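import Literature.Computability.AlgebraicComplexity.HashedZeroOut
import Literature.Computability.AlgebraicComplexity.MoreAsymmetricCleanup
import HarnessLib

/-!
# The structure of a MORE ASYMMETRIC hashed stage in abstract form: after the `Y`- and `Z`-compatibility
and usefulness zero-outs the tensor is a direct sum, over the triples of `𝒯_hash`, of broken copies of the
useful sub-tensors (Alman–Duan–Vassilevska Williams–Xu–Xu–Zhou 2025, §5.3–§5.5 and §6.3–§6.5: Claims 5.7,
5.10, 5.12 / 6.9, 6.12 and `𝒯_ZUseful = ⊕ 𝒯_ZUseful|_{X_I Y_J Z_K}`) — proved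

Topic `Literature/Computability/AlgebraicComplexity`.  The global stage (§5) and the constituent stage (§6)
of Alman–Duan–Vassilevska Williams–Xu–Xu–Zhou, *More asymmetry yields faster matrix multiplication*
(SODA 2025, arXiv:2404.16349) share their deterministic skeleton ("The framework for our constituent stage
algorithm is almost identical to the framework for our global stage algorithm"): hash the block triples of a
universe `𝒯` so that only the `X`-blocks are in unique triples (`MoreAsymmetricCleanup.xPresentTriples`), zero
out the level-1 `X`-blocks not USEFUL for the unique triple of their block, the level-1 `Y`-blocks not
typical / `Y`-COMPATIBLE with more than one triple / not useful (§5.3, §6.3), and the level-1 `Z`-blocks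
likewise (§5.4, §6.4); the result is level-1-independent and splits as a direct sum over the triples of
`𝒯_hash` of copies of the useful sub-tensor `𝒯*` with holes in the `Y`- and `Z`-dimensions (Claims 5.7,
5.10, 5.12, resp. 6.9, 6.12 and §6.5).  The tree's `MoreAsymmetricStructure.lean` does this for the §5 data;
this file PROVES it once in ABSTRACT form — the twin of `HashedZeroOut.lean` (the VXXZ skeleton, `X`- and
`Y`-blocks unique) — for

* an arbitrary universe `𝒯` of block triples on `N` chunk positions with `𝒯α ⊆ 𝒯` and buckets `B`,
* arbitrary usefulness predicates `UX, UY, UZ` and compatibility predicates `CY` (triple, level-1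
  `Y`-sequence) and `CZ`, and
* an AMBIENT zero-out given by sets `AX, AY, AZ` of admitted level-1 sequences (§6: the level-1 blocks of
  the input interface tensor; §5: everything),

under the hypotheses `WellFormed`: `𝒯α ⊆ 𝒯`; `𝒯` closed under recombining blocks into level triples; on
`𝒯α` usefulness implies compatibility in `Y` and in `Z`; the core of **Claim 5.7 / 6.9**: for complementary
level-1 sequences `Î + Ĵ + K̂ = 2⃗` with `Î` useful for the triple `T₀ ∈ 𝒯α` of their blocks and `Ĵ` useful for
some triple of `𝒯α` through `Y_J`, `Ĵ` is `Y`-compatible with `T₀`; and the core of **Claim 5.10 / 6.12**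
(as in `HashedZeroOut`).  Results:

* `respectsAssignment` — **level-1-independence** of the zeroed-out tensor (`finalTensor`);
* `finalTensor_restrictsTo_directSum` / `directSum_restrictsTo_finalTensor` — direct sum over `𝒯_hash`;
* `summand_eq_brokenCopy` — **the summand over a triple `T` of `𝒯_hash` is the useful sub-tensor
  `usefulSub T` restricted to the ambient blocks, with the `Y`-holes `holesY T` and the `Z`-holes `holesZ T`
  (useful blocks compatible with another triple of `𝒯_hash` through `Y_J`, resp. `Z_K`) removed**: a broken
  copy of `𝒯*_T` whose holes are `AXᶜ`, `AYᶜ ∪ holesY T` and `AZᶜ ∪ holesZ T`.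

Everything is proved; the definitions are the zero-out predicates, the assignment, `usefulSub` and
`summand`; no named facts.

## References

* J. Alman, R. Duan, V. Vassilevska Williams, Y. Xu, Z. Xu, R. Zhou, *More asymmetry yields faster
  matrix multiplication*, SODA 2025, arXiv:2404.16349 (held: `paper:arxiv-2404.16349`, chunks
  p0016–p0019, p0023–p0025): §5.2–§5.5 (𝒯_hash, Claims 5.7, 5.10, 5.12), §6 preamble, §6.2–§6.5
  (Defs. 6.8, 6.10, 6.11, 6.13, Claims 6.9, 6.12, the two kinds of holes).
  [AlmanDuanVassilevskaWilliamsXuXuZhou2025]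
* V. Vassilevska Williams, Y. Xu, Z. Xu, R. Zhou, *New bounds for matrix multiplication: from alpha
  to omega*, SODA 2024, arXiv:2307.07970, §5.3–§5.5 and §6.3–§6.5 (the two-dimensional skeleton).
  [VassilevskaWilliamsXuXuZhou2024]
-/

noncomputable section

open scoped BigOperators
open Finset

namespace Literature.Computability.AlgebraicComplexity

open Literature.Barriers.MatrixMultiplication (bigCwTensor)

universe u

/-- **The data of a more asymmetric hashed stage**: a hashed stage (`HashedZeroOut`: universe `𝒯`,
distinguished triples `𝒯α`, buckets `B`, usefulness predicates, `Z`-compatibility, ambient admitted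
sequences) together with a `Y`-compatibility predicate. [cite: AlmanDuanVassilevskaWilliamsXuXuZhou2025, §5.2–§5.5 and §6.2–§6.5] -/
structure MoreAsymHashedZeroOut (c N M : ℕ) extends HashedZeroOut c N M where
  /-- compatibility of a level-1 `Y`-sequence with a triple (Def. 5.6 / 6.8) -/
  CY : (Fin N → Fin (2 * c + 1)) × (Fin N → Fin (2 * c + 1)) × (Fin N → Fin (2 * c + 1)) → (Fin N → Fin c → Fin 3) → Prop

namespace MoreAsymHashedZeroOut

open scoped Classical

variable {c N M : ℕ} (S : MoreAsymHashedZeroOut c N M)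

/-- The triples of `𝒯_hash` (present after the more asymmetric hashing with seed `ω`: `X`-blocks unique).
[cite: AlmanDuanVassilevskaWilliamsXuXuZhou2025, §5.2 and §6.2 (𝒯_hash)] -/
abbrev present (ω : VxxzSeed M N) :
    Finset ((Fin N → Fin (2 * c + 1)) × (Fin N → Fin (2 * c + 1)) × (Fin N → Fin (2 * c + 1))) :=
  xPresentTriples (2 * c) S.𝒯 S.𝒯α ω S.B

/-! ### The kept level-1 blocks -/

/-- **`X_Î` is kept**: admitted, and its block lies in a triple of `𝒯_hash` for which `Î` is useful.
[cite: AlmanDuanVassilevskaWilliamsXuXuZhou2025, §5.3 and §6.3 ("we zero out level-1 blocks X_Î where … split(Î, S_{t,i',j',k'}) ≠ β_{X,t,i',j',k'}")] -/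
def keepX (ω : VxxzSeed M N) (Ih : Fin N → Fin c → Fin 3) : Prop :=
  Ih ∈ S.AX ∧ ∃ T ∈ S.present ω, T.1 = blockOfSeq Ih ∧ S.UX T Ih

/-- **`Y_Ĵ` is kept**: admitted, and there is a triple of `𝒯_hash` through `Y_J` for which `Ĵ` is useful and
which is the only triple of `𝒯_hash` through `Y_J` with which `Ĵ` is `Y`-compatible (`Y`-compatibility
zero-outs I–II and the `Y`-usefulness zero-out). [cite: AlmanDuanVassilevskaWilliamsXuXuZhou2025, §5.3.1–§5.3.3 and §6.3.1–§6.3.3] -/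
def keepY (ω : VxxzSeed M N) (Jh : Fin N → Fin c → Fin 3) : Prop :=
  Jh ∈ S.AY ∧ ∃ T ∈ S.present ω, T.2.1 = blockOfSeq Jh ∧ S.UY T Jh ∧
    ∀ T' ∈ S.present ω, T'.2.1 = blockOfSeq Jh → S.CY T' Jh → T' = T

/-- **`Z_K̂` is kept** (`Z`-compatibility zero-outs I–II and the `Z`-usefulness zero-out).
[cite: AlmanDuanVassilevskaWilliamsXuXuZhou2025, §5.4 and §6.4] -/
def keepZ (ω : VxxzSeed M N) (Kh : Fin N → Fin c → Fin 3) : Prop :=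
  Kh ∈ S.AZ ∧ ∃ T ∈ S.present ω, T.2.2 = blockOfSeq Kh ∧ S.UZ T Kh ∧
    ∀ T' ∈ S.present ω, T'.2.2 = blockOfSeq Kh → S.CZ T' Kh → T' = T

/-- **The `Y`-holes of the copy over the triple `T`**: useful `Y`-sequences `Y`-compatible with another
triple of `𝒯_hash` through `Y_J`. [cite: AlmanDuanVassilevskaWilliamsXuXuZhou2025, Claim 5.12 and §6.5 (missing Y variables)] -/
def holesY (ω : VxxzSeed M N) (T : (Fin N → Fin (2 * c + 1)) × (Fin N → Fin (2 * c + 1)) × (Fin N → Fin (2 * c + 1))) :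
    Finset (Fin N → Fin c → Fin 3) :=
  univ.filter fun Jh => blockOfSeq Jh = T.2.1 ∧ S.UY T Jh ∧
    ∃ T' ∈ S.present ω, T' ≠ T ∧ T'.2.1 = T.2.1 ∧ S.CY T' Jh

/-- **The `Z`-holes of the copy over the triple `T`**: useful `Z`-sequences compatible with another triple
of `𝒯_hash` through `Z_K`. [cite: AlmanDuanVassilevskaWilliamsXuXuZhou2025, Claim 5.12 and §6.5 (missing Z variables)] -/
def holesZ (ω : VxxzSeed M N) (T : (Fin N → Fin (2 * c + 1)) × (Fin N → Fin (2 * c + 1)) × (Fin N → Fin (2 * c + 1))) :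
    Finset (Fin N → Fin c → Fin 3) :=
  univ.filter fun Kh => blockOfSeq Kh = T.2.2 ∧ S.UZ T Kh ∧
    ∃ T' ∈ S.present ω, T' ≠ T ∧ T'.2.2 = T.2.2 ∧ S.CZ T' Kh

variable (R : Type u) [CommSemiring R] (q : ℕ)

/-- **The final tensor** (`𝒯_ZUseful`): the zero-out of `(CW_q^{⊗c})^{⊗N}` keeping the kept level-1 blocks.
[cite: AlmanDuanVassilevskaWilliamsXuXuZhou2025, §5.4.3 and §6.4.3 (𝒯_ZUseful)] -/
def finalTensor (ω : VxxzSeed M N) :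
    (Fin N → Fin c → Fin (q + 2)) → (Fin N → Fin c → Fin (q + 2)) → (Fin N → Fin c → Fin (q + 2)) → R :=
  partSubtensor levelSeq levelSeq levelSeq (kroneckerPow (kroneckerPow (bigCwTensor R q) c) N)
    (univ.filter (S.keepX ω)) (univ.filter (S.keepY ω)) (univ.filter (S.keepZ ω))

/-- **The useful sub-tensor `𝒯*_T`** over the triple `T` (as in `HashedZeroOut.usefulSub`).
[cite: AlmanDuanVassilevskaWilliamsXuXuZhou2025, §5.5 and §6.5 (𝒯*)] -/
def usefulSub (T : (Fin N → Fin (2 * c + 1)) × (Fin N → Fin (2 * c + 1)) × (Fin N → Fin (2 * c + 1))) :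
    (Fin N → Fin c → Fin (q + 2)) → (Fin N → Fin c → Fin (q + 2)) → (Fin N → Fin c → Fin (q + 2)) → R :=
  partSubtensor levelSeq levelSeq levelSeq (kroneckerPow (kroneckerPow (bigCwTensor R q) c) N)
    (univ.filter fun Ih => blockOfSeq Ih = T.1 ∧ S.UX T Ih) (univ.filter fun Jh => blockOfSeq Jh = T.2.1 ∧ S.UY T Jh)
    (univ.filter fun Kh => blockOfSeq Kh = T.2.2 ∧ S.UZ T Kh)

/-! ### The assignment of the kept level-1 blocks to the triples of `𝒯_hash` -/

/-- The triple of a kept `X`-sequence (`none` if not kept). [cite: AlmanDuanVassilevskaWilliamsXuXuZhou2025, §5.5 and §6.5 (level-1-independence)] -/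
def assignX (ω : VxxzSeed M N) (Ih : Fin N → Fin c → Fin 3) : Option ↥(S.present ω) :=
  if h : S.keepX ω Ih then some ⟨h.2.choose, h.2.choose_spec.1⟩ else none

/-- The triple of a kept `Y`-sequence (the unique `Y`-compatible one). [cite: AlmanDuanVassilevskaWilliamsXuXuZhou2025, §5.3.2 and §6.3.2] -/
def assignY (ω : VxxzSeed M N) (Jh : Fin N → Fin c → Fin 3) : Option ↥(S.present ω) :=
  if h : S.keepY ω Jh then some ⟨h.2.choose, h.2.choose_spec.1⟩ else none

/-- The triple of a kept `Z`-sequence (the unique compatible one). [cite: AlmanDuanVassilevskaWilliamsXuXuZhou2025, §5.4.2 and §6.4.2] -/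
def assignZ (ω : VxxzSeed M N) (Kh : Fin N → Fin c → Fin 3) : Option ↥(S.present ω) :=
  if h : S.keepZ ω Kh then some ⟨h.2.choose, h.2.choose_spec.1⟩ else none

variable {S R q}

/-- `assignX Î = T` iff `Î` is admitted, lies in `X_{T.1}` and is useful for `T` (the triple of `𝒯_hash`
through an `X`-block is unique). [cite: AlmanDuanVassilevskaWilliamsXuXuZhou2025, §5.2–§5.3 and §6.2–§6.3] -/
theorem assignX_eq_some_iff {ω : VxxzSeed M N} {Ih : Fin N → Fin c → Fin 3} {T : ↥(S.present ω)} :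
    S.assignX ω Ih = some T ↔ Ih ∈ S.AX ∧ T.1.1 = blockOfSeq Ih ∧ S.UX T.1 Ih := by
  unfold assignX
  split_ifs with h
  · have hc := h.2.choose_spec
    constructor
    · intro he
      have he' := Subtype.ext_iff.1 (Option.some_injective _ he)
      simp only at he'
      rw [← he']
      exact ⟨h.1, hc.2.1, hc.2.2⟩
    · rintro ⟨-, h1, hu⟩
      congr 1
      apply Subtype.ext
      exact xPresentTriples_eq_of_fst_eq hc.1 T.2 (hc.2.1.trans h1.symm)
  · constructor
    · intro he; exact absurd he (by simp)
    · rintro ⟨hA, h1, hu⟩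
      exact absurd ⟨hA, T.1, T.2, h1, hu⟩ h

variable (S) in
/-- **The standing hypotheses**: `𝒯α ⊆ 𝒯`; `𝒯` contains every level triple assembled from the blocks of
three of its members; on `𝒯α` usefulness implies `Y`-compatibility and `Z`-compatibility; the core of
**Claim 5.7 / 6.9**: for complementary level-1 sequences (`Î + Ĵ + K̂ = 2⃗`) with `Î` useful for the triple
`T₀ ∈ 𝒯α` of their blocks and `Ĵ` useful for some `T₂ ∈ 𝒯α` through `Y_J`, `Ĵ` is `Y`-compatible with `T₀`;
and the core of **Claim 5.10 / 6.12**: with `Î`, `Ĵ` useful for `T₀` and `K̂` useful for some `T₃ ∈ 𝒯α`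
through `Z_K`, `K̂` is compatible with `T₀`. [cite: AlmanDuanVassilevskaWilliamsXuXuZhou2025, Claims 5.7, 5.10 / 6.9, 6.12 and Defs. 5.6–5.11 / 6.8–6.13] -/
structure WellFormed : Prop where
  /-- the distinguished triples lie in the universe -/
  subset : S.𝒯α ⊆ S.𝒯
  /-- the universe is closed under recombination of blocks into level triples -/
  closed : ∀ T₁ ∈ S.𝒯, ∀ T₂ ∈ S.𝒯, ∀ T₃ ∈ S.𝒯,
    ∀ T₀ : (Fin N → Fin (2 * c + 1)) × (Fin N → Fin (2 * c + 1)) × (Fin N → Fin (2 * c + 1)),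
      T₀.1 = T₁.1 → T₀.2.1 = T₂.2.1 → T₀.2.2 = T₃.2.2 →
        (∀ p, seqVal T₀.1 p + seqVal T₀.2.1 p + seqVal T₀.2.2 p = 2 * c) → T₀ ∈ S.𝒯
  /-- useful `Y`-sequences are `Y`-compatible -/
  usefulCompatibleY : ∀ T ∈ S.𝒯α, ∀ Jh, S.UY T Jh → S.CY T Jh
  /-- useful `Z`-sequences are compatible -/
  usefulCompatibleZ : ∀ T ∈ S.𝒯α, ∀ Kh, S.UZ T Kh → S.CZ T Kh
  /-- Claim 5.7 / 6.9 -/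
  claim57 : ∀ Ih Jh Kh : Fin N → Fin c → Fin 3, (∀ u p, (Ih u p : ℕ) + Jh u p + Kh u p = 2) →
    (blockOfSeq Ih, blockOfSeq Jh, blockOfSeq Kh) ∈ S.𝒯α →
      S.UX (blockOfSeq Ih, blockOfSeq Jh, blockOfSeq Kh) Ih →
        ∀ T₂ ∈ S.𝒯α, T₂.2.1 = blockOfSeq Jh → S.UY T₂ Jh → S.CY (blockOfSeq Ih, blockOfSeq Jh, blockOfSeq Kh) Jh
  /-- Claim 5.10 / 6.12 -/
  claim510 : ∀ Ih Jh Kh : Fin N → Fin c → Fin 3, (∀ u p, (Ih u p : ℕ) + Jh u p + Kh u p = 2) →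
    (blockOfSeq Ih, blockOfSeq Jh, blockOfSeq Kh) ∈ S.𝒯α →
      S.UX (blockOfSeq Ih, blockOfSeq Jh, blockOfSeq Kh) Ih → S.UY (blockOfSeq Ih, blockOfSeq Jh, blockOfSeq Kh) Jh →
        ∀ T₃ ∈ S.𝒯α, T₃.2.2 = blockOfSeq Kh → S.UZ T₃ Kh → S.CZ (blockOfSeq Ih, blockOfSeq Jh, blockOfSeq Kh) Kh

/-- `assignY Ĵ = T` iff `Ĵ` is admitted, lies in `Y_{T.2.1}`, is useful for `T`, and `T` is the only triple of
`𝒯_hash` through `Y_J` with which `Ĵ` is `Y`-compatible. [cite: AlmanDuanVassilevskaWilliamsXuXuZhou2025, §5.3.2–§5.3.3 and §6.3.2–§6.3.3] -/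
theorem assignY_eq_some_iff (hS : S.WellFormed) {ω : VxxzSeed M N} {Jh : Fin N → Fin c → Fin 3} {T : ↥(S.present ω)} :
    S.assignY ω Jh = some T ↔ Jh ∈ S.AY ∧ T.1.2.1 = blockOfSeq Jh ∧ S.UY T.1 Jh ∧
      ∀ T' ∈ S.present ω, T'.2.1 = blockOfSeq Jh → S.CY T' Jh → T' = T.1 := by
  unfold assignY
  split_ifs with h
  · have hc := h.2.choose_spec
    constructor
    · intro he
      have he' := Subtype.ext_iff.1 (Option.some_injective _ he)
      simp only at he'
      rw [← he']
      exact ⟨h.1, hc.2.1, hc.2.2.1, hc.2.2.2⟩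
    · rintro ⟨-, h1, hu, huniq⟩
      have hcompat : S.CY h.2.choose Jh := hS.usefulCompatibleY _ (xPresentTriples_subset hc.1) _ hc.2.2.1
      have heq : h.2.choose = T.1 := huniq _ hc.1 hc.2.1 hcompat
      congr 1
      exact Subtype.ext heq
  · constructor
    · intro he; exact absurd he (by simp)
    · rintro ⟨hA, h1, hu, huniq⟩
      exact absurd ⟨hA, T.1, T.2, h1, hu, huniq⟩ h

/-- `assignZ K̂ = T` iff `K̂` is admitted, lies in `Z_{T.2.2}`, is useful for `T`, and `T` is the only triple of
`𝒯_hash` through `Z_K` compatible with `K̂`. [cite: AlmanDuanVassilevskaWilliamsXuXuZhou2025, §5.4 and §6.4] -/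
theorem assignZ_eq_some_iff (hS : S.WellFormed) {ω : VxxzSeed M N} {Kh : Fin N → Fin c → Fin 3} {T : ↥(S.present ω)} :
    S.assignZ ω Kh = some T ↔ Kh ∈ S.AZ ∧ T.1.2.2 = blockOfSeq Kh ∧ S.UZ T.1 Kh ∧
      ∀ T' ∈ S.present ω, T'.2.2 = blockOfSeq Kh → S.CZ T' Kh → T' = T.1 := by
  unfold assignZ
  split_ifs with h
  · have hc := h.2.choose_spec
    constructor
    · intro he
      have he' := Subtype.ext_iff.1 (Option.some_injective _ he)
      simp only at he'
      rw [← he']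
      exact ⟨h.1, hc.2.1, hc.2.2.1, hc.2.2.2⟩
    · rintro ⟨-, h1, hu, huniq⟩
      have hcompat : S.CZ h.2.choose Kh := hS.usefulCompatibleZ _ (xPresentTriples_subset hc.1) _ hc.2.2.1
      have heq : h.2.choose = T.1 := huniq _ hc.1 hc.2.1 hcompat
      congr 1
      exact Subtype.ext heq
  · constructor
    · intro he; exact absurd he (by simp)
    · rintro ⟨hA, h1, hu, huniq⟩
      exact absurd ⟨hA, T.1, T.2, h1, hu, huniq⟩ h

/-! ### Level-1-independence -/

/-- **Level-1-independence of the final tensor**: every non-zero entry of the power all three of whose level-1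
blocks are kept has them assigned to ONE triple of `𝒯_hash` — the `X`-block by the uniqueness of the triple
through a kept `X`-block, the `Y`-block by Claim 5.7 / 6.9 and the uniqueness recorded in `keepY`, the
`Z`-block by Claim 5.10 / 6.12 and the uniqueness in `keepZ`. [cite: AlmanDuanVassilevskaWilliamsXuXuZhou2025, §5.5 and §6.5 (level-1-independence), Claims 5.7, 5.10 / 6.9, 6.12] -/
theorem respectsAssignment (hS : S.WellFormed) (R : Type u) [CommSemiring R] (q : ℕ) (ω : VxxzSeed M N) :
    RespectsAssignment levelSeq levelSeq levelSeq (kroneckerPow (kroneckerPow (bigCwTensor R q) c) N)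
      (S.assignX ω) (S.assignY ω) (S.assignZ ω) := by
  intro x y z T₁ T₂ T₃ hne h1 h2 h3
  rw [assignX_eq_some_iff] at h1
  rw [assignY_eq_some_iff hS] at h2
  rw [assignZ_eq_some_iff hS] at h3
  obtain ⟨-, hI, huX⟩ := h1
  obtain ⟨-, hJ, huY, huniqY⟩ := h2
  obtain ⟨-, hK, huZ, huniqZ⟩ := h3
  set T₀ : (Fin N → Fin (2 * c + 1)) × (Fin N → Fin (2 * c + 1)) × (Fin N → Fin (2 * c + 1)) :=
    (blockOfSeq (levelSeq x), blockOfSeq (levelSeq y), blockOfSeq (levelSeq z)) with hT₀def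
  obtain ⟨hT₁𝒯, hT₁x, -, -⟩ := mem_xPresentTriples.1 T₁.2
  obtain ⟨hT₂𝒯, -, hT₂y, -⟩ := mem_xPresentTriples.1 T₂.2
  obtain ⟨hT₃𝒯, -, -, hT₃z⟩ := mem_xPresentTriples.1 T₃.2
  have hlev := isLevelTriple_of_ne_zero R q hne
  have hT₀ : T₀ ∈ S.𝒯 := by
    refine hS.closed _ hT₁𝒯 _ hT₂𝒯 _ hT₃𝒯 T₀ hI.symm hJ.symm hK.symm fun p => ?_
    have := hlev p
    simpa [hT₀def, chunkLevels_eq_seqVal_blockOfSeq] using this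
  rw [hI] at hT₁x
  rw [hJ] at hT₂y
  rw [hK] at hT₃z
  have hT₀p : T₀ ∈ hashPresent (2 * c) S.𝒯 ω S.B :=
    mem_hashPresent.2 ⟨hT₀, (mem_keptX.1 hT₁x).2.1, (mem_xKeptY.1 hT₂y).2, (mem_keptZ.1 hT₃z).2⟩
  -- `T₁ = T₀` by the uniqueness of the hash-present triple through a kept `X`-block
  have e₁ : T₁.1 = T₀ := hashPresent_unique_of_mem_keptX hT₁x (hashPresent_of_mem_xPresentTriples T₁.2) hT₀p hI rfl
  have hT₀pr : T₀ ∈ S.present ω := e₁ ▸ T₁.2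
  have hT₀α : T₀ ∈ S.𝒯α := xPresentTriples_subset hT₀pr
  have huX' : S.UX T₀ (levelSeq x) := by rw [← e₁]; exact huX
  -- `T₂ = T₀` by Claim 5.7 / 6.9
  have hcompatY : S.CY T₀ (levelSeq y) :=
    hS.claim57 (levelSeq x) (levelSeq y) (levelSeq z) (levelSeq_add_of_ne_zero R q hne) hT₀α huX'
      T₂.1 (xPresentTriples_subset T₂.2) hJ huY
  have e₂ : T₀ = T₂.1 := huniqY _ hT₀pr rfl hcompatY
  have h12 : T₁ = T₂ := Subtype.ext (e₁.trans e₂)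
  -- `T₃ = T₀` by Claim 5.10 / 6.12
  have huY' : S.UY T₀ (levelSeq y) := by rw [e₂]; exact huY
  have hcompatZ : S.CZ T₀ (levelSeq z) :=
    hS.claim510 (levelSeq x) (levelSeq y) (levelSeq z) (levelSeq_add_of_ne_zero R q hne) hT₀α huX' huY'
      T₃.1 (xPresentTriples_subset T₃.2) hK huZ
  have e₃ : T₀ = T₃.1 := huniqZ _ hT₀pr rfl hcompatZ
  exact ⟨h12, Subtype.ext (e₂.symm.trans e₃)⟩

/-! ### The final tensor is the direct sum of its summands -/

/-- The kept parts of the assignment are the kept blocks (`X`). [folklore] -/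
theorem keptParts_assignX (ω : VxxzSeed M N) : keptParts (S.assignX ω) = univ.filter (S.keepX ω) := by
  ext Ih
  rw [mem_keptParts, mem_filter]
  simp only [mem_univ, true_and, assignX]
  split_ifs with h <;> simp [h]

/-- The kept parts of the assignment are the kept blocks (`Y`). [folklore] -/
theorem keptParts_assignY (ω : VxxzSeed M N) : keptParts (S.assignY ω) = univ.filter (S.keepY ω) := by
  ext Jh
  rw [mem_keptParts, mem_filter]
  simp only [mem_univ, true_and, assignY]
  split_ifs with h <;> simp [h]

/-- The kept parts of the assignment are the kept blocks (`Z`). [folklore] -/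
theorem keptParts_assignZ (ω : VxxzSeed M N) : keptParts (S.assignZ ω) = univ.filter (S.keepZ ω) := by
  ext Kh
  rw [mem_keptParts, mem_filter]
  simp only [mem_univ, true_and, assignZ]
  split_ifs with h <;> simp [h]

variable (S R q) in
/-- **The summand of the final tensor over the triple `T` of `𝒯_hash`.** [cite: AlmanDuanVassilevskaWilliamsXuXuZhou2025, §5.5 and §6.5 (𝒯_ZUseful|_{X_I Y_J Z_K})] -/
def summand (ω : VxxzSeed M N) (T : ↥(S.present ω)) :
    (Fin N → Fin c → Fin (q + 2)) → (Fin N → Fin c → Fin (q + 2)) → (Fin N → Fin c → Fin (q + 2)) → R :=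
  partSubtensor levelSeq levelSeq levelSeq (kroneckerPow (kroneckerPow (bigCwTensor R q) c) N)
    (assignedParts (S.assignX ω) T) (assignedParts (S.assignY ω) T) (assignedParts (S.assignZ ω) T)

/-- The final tensor as the kept tensor of the assignment. [folklore] -/
theorem finalTensor_eq (R : Type u) [CommSemiring R] (q : ℕ) (ω : VxxzSeed M N) :
    S.finalTensor R q ω = partSubtensor levelSeq levelSeq levelSeq (kroneckerPow (kroneckerPow (bigCwTensor R q) c) N)
      (keptParts (S.assignX ω)) (keptParts (S.assignY ω)) (keptParts (S.assignZ ω)) := by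
  rw [keptParts_assignX, keptParts_assignY, keptParts_assignZ, finalTensor]

/-- **`final ≥ ⊕_{T ∈ 𝒯_hash} (summand T)`.** [cite: AlmanDuanVassilevskaWilliamsXuXuZhou2025, §5.5 and §6.5] -/
theorem finalTensor_restrictsTo_directSum (hS : S.WellFormed) (R : Type u) [CommSemiring R] (q : ℕ) (ω : VxxzSeed M N) :
    TensorRestrictsTo (S.finalTensor R q ω) (familyDirectSum fun T : ↥(S.present ω) => S.summand R q ω T) := by
  rw [finalTensor_eq]
  exact partSubtensor_kept_restrictsTo_familyDirectSum _ (respectsAssignment hS R q ω)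

/-- **`⊕_{T ∈ 𝒯_hash} (summand T) ≥ final`.** [cite: AlmanDuanVassilevskaWilliamsXuXuZhou2025, §5.5 and §6.5] -/
theorem directSum_restrictsTo_finalTensor (hS : S.WellFormed) (R : Type u) [CommSemiring R] (q : ℕ) (ω : VxxzSeed M N) :
    TensorRestrictsTo (familyDirectSum fun T : ↥(S.present ω) => S.summand R q ω T) (S.finalTensor R q ω) := by
  rw [finalTensor_eq]
  exact familyDirectSum_restrictsTo_partSubtensor_kept _ (respectsAssignment hS R q ω)

/-! ### Each summand is a broken copy of the useful sub-tensor -/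

/-- The `X`-parts assigned to `T`: admitted, in `X_I`, useful (no second-kind `X`-holes). [cite: AlmanDuanVassilevskaWilliamsXuXuZhou2025, Claim 5.12 (proof, item 1) and §6.5] -/
theorem assignedParts_assignX {ω : VxxzSeed M N} (T : ↥(S.present ω)) :
    assignedParts (S.assignX ω) T = (univ.filter fun Ih => blockOfSeq Ih = T.1.1 ∧ S.UX T.1 Ih) ∩ S.AX := by
  ext Ih
  rw [mem_assignedParts, assignX_eq_some_iff, mem_inter, mem_filter]
  simp only [mem_univ, true_and]
  exact ⟨fun h => ⟨⟨h.2.1.symm, h.2.2⟩, h.1⟩, fun h => ⟨h.2, h.1.1.symm, h.1.2⟩⟩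

/-- The `Y`-parts assigned to `T`: admitted, useful and NOT a `Y`-hole. [cite: AlmanDuanVassilevskaWilliamsXuXuZhou2025, Claim 5.12 (the missing Y variables) and §6.5] -/
theorem assignedParts_assignY (hS : S.WellFormed) {ω : VxxzSeed M N} (T : ↥(S.present ω)) :
    assignedParts (S.assignY ω) T =
      (univ.filter fun Jh => blockOfSeq Jh = T.1.2.1 ∧ S.UY T.1 Jh) ∩ (S.AY \ S.holesY ω T.1) := by
  ext Jh
  rw [mem_assignedParts, assignY_eq_some_iff hS, mem_inter, mem_sdiff, mem_filter, holesY, mem_filter]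
  simp only [mem_univ, true_and]
  constructor
  · rintro ⟨hA, h1, hu, huniq⟩
    refine ⟨⟨h1.symm, hu⟩, hA, ?_⟩
    rintro ⟨-, -, T', hT', hne, h2, hc⟩
    exact hne (huniq T' hT' (h2.trans h1) hc)
  · rintro ⟨⟨h1, hu⟩, hA, hnot⟩
    refine ⟨hA, h1.symm, hu, fun T' hT' h2 hc => ?_⟩
    by_contra hne
    exact hnot ⟨h1, hu, T', hT', hne, h2.trans h1, hc⟩

/-- The `Z`-parts assigned to `T`: admitted, useful and NOT a `Z`-hole. [cite: AlmanDuanVassilevskaWilliamsXuXuZhou2025, Claim 5.12 (the missing Z variables) and §6.5] -/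
theorem assignedParts_assignZ (hS : S.WellFormed) {ω : VxxzSeed M N} (T : ↥(S.present ω)) :
    assignedParts (S.assignZ ω) T =
      (univ.filter fun Kh => blockOfSeq Kh = T.1.2.2 ∧ S.UZ T.1 Kh) ∩ (S.AZ \ S.holesZ ω T.1) := by
  ext Kh
  rw [mem_assignedParts, assignZ_eq_some_iff hS, mem_inter, mem_sdiff, mem_filter, holesZ, mem_filter]
  simp only [mem_univ, true_and]
  constructor
  · rintro ⟨hA, h1, hu, huniq⟩
    refine ⟨⟨h1.symm, hu⟩, hA, ?_⟩
    rintro ⟨-, -, T', hT', hne, h2, hc⟩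
    exact hne (huniq T' hT' (h2.trans h1) hc)
  · rintro ⟨⟨h1, hu⟩, hA, hnot⟩
    refine ⟨hA, h1.symm, hu, fun T' hT' h2 hc => ?_⟩
    by_contra hne
    exact hnot ⟨h1, hu, T', hT', hne, h2.trans h1, hc⟩

/-- **The summand over a triple of `𝒯_hash` is a broken copy of the useful sub-tensor**: `𝒯*_T` with the
`X`-blocks outside the ambient set, the `Y`-blocks outside the ambient set or `Y`-compatible with another
triple of `𝒯_hash`, and the `Z`-blocks outside the ambient set or compatible with another triple zeroed out.
[cite: AlmanDuanVassilevskaWilliamsXuXuZhou2025, Claim 5.12 and §6.5 ("the holes")] -/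
theorem summand_eq_brokenCopy (hS : S.WellFormed) (R : Type u) [CommSemiring R] (q : ℕ) {ω : VxxzSeed M N}
    (T : ↥(S.present ω)) :
    S.summand R q ω T =
      partSubtensor levelSeq levelSeq levelSeq (S.usefulSub R q T.1) S.AX (S.AY \ S.holesY ω T.1) (S.AZ \ S.holesZ ω T.1) := by
  rw [summand, usefulSub, partSubtensor_partSubtensor, assignedParts_assignX, assignedParts_assignY hS,
    assignedParts_assignZ hS]

end MoreAsymHashedZeroOut

end Literature.Computability.AlgebraicComplexity
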